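import Summits.QuantumFields.YangMills.Theorems.LuscherReductionOneSiteLevelsMagPhase
import Summits.QuantumFields.YangMills.Theorems.LuscherReductionOneSiteLevelsOuterSeam

/-!
# The VALLEY stub made concrete: with the magnetic phase `magPhase √λ_b`, OUTER follows from ONE analytic bound
# (support module for the VALLEY re-cut of `stub_absUpperOuter`, crux `OneSiteLevels`, route `LuscherReduction`, item stmt-QuantumFields-20007;
# fleet lead prover ym-luscher-20007-p1)

`absUpperOuter_of_valley` (OuterSeam) takes an abstract magnetic phase; `Theorems/LuscherReductionOneSiteLevelsMagPhase.lean` verifies all its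
(PHASE′) hypotheses for `Φ_B = magPhase (onePhaseScale B)` (threshold `η_B = √λ_b`).  Hence (`absUpperOuter_of_valleyMag`) `OneSiteAbsUpperOuter k`
follows from the single concrete statement

  (VALLEY-MAG k)  `∃ C₁ B₁ ≥ 2, ∀ B ≥ B₁, ∀ physical ψ:`
     `⟨cos Φ_B sin Θ_B ψ, K_B cos Φ_B sin Θ_B ψ⟩ ≤ linkCE B · e^{−E_kλ_b + C₁λ_b²} ‖cos Φ_B sin Θ_B ψ‖²`,
     `Φ_B = magPhase (onePhaseScale B)` (supported in `{S < 2√λ_b}`), `Θ_B = onePhase (onePhaseScale B)` (some link `> √λ_b` from `±1`)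

— the transverse-confinement estimate near the commuting-triple valley, the L-sized analytic content of OUTER, with every localisation
constant fixed (`A′ = 144π²`, large-field factor `e^{−B√λ_b}`).

## WHAT THIS IS NOT
The valley estimate itself is not proved; NOT the crux, NOT THE CLAY GAP.  Sorry-free; no new definition, no named fact.
-/

set_option autoImplicit false

noncomputable section

open MeasureTheory Filter Topology Real
open scoped Matrix ComplexConjugate BigOperators
open Literature.MathematicalPhysics.QuantumFieldTheory
open Literature.MathematicalPhysics.QuantumLattice
open Literature.Analysis.OperatorTheory.YMMatrixModel

namespace Summit.QuantumFields.YangMills.Theorems.FemtoTransferGap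

/-- **OUTER from the concrete VALLEY bound.**  If for `B ≥ B₁ ≥ 2` the valley piece `cos Φ_B · sin Θ_B · ψ` (`Φ_B = magPhase √λ_b`,
`Θ_B = onePhase √λ_b`) of every physical `ψ` obeys the rate `linkCE B·e^{−E_kλ_b + C₁λ_b²}`, then the whole `sin Θ_B`-piece does
(`OneSiteAbsUpperOuter k`). [cite: SimonB1983DiscreteSpectrum, §3] [cite: Luscher1983, §2] -/
theorem absUpperOuter_of_valleyMag (k : ℕ) {C₁ B₁ : ℝ} (hB₁ : 2 ≤ B₁)
    (hval : ∀ B, B₁ ≤ B → ∀ ψ : Cfg → ℝ, IsPhys ψ →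
      qform su2Rep B (fun U => Real.cos (magPhase (onePhaseScale B) U) * (Real.sin (onePhase (onePhaseScale B) U) * ψ U))
          (fun U => Real.cos (magPhase (onePhaseScale B) U) * (Real.sin (onePhase (onePhaseScale B) U) * ψ U))
        ≤ linkCE B * Real.exp (-(physLevel (k + 1) * bareLambda B) + C₁ * bareLambda B ^ 2)
          * l2 (fun U => Real.cos (magPhase (onePhaseScale B) U) * (Real.sin (onePhase (onePhaseScale B) U) * ψ U))
               (fun U => Real.cos (magPhase (onePhaseScale B) U) * (Real.sin (onePhase (onePhaseScale B) U) * ψ U))) :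
    ∃ C₂ B₂ : ℝ, 2 ≤ B₂ ∧ ∀ B, B₂ ≤ B → ∀ ψ : Cfg → ℝ, IsPhys ψ →
      qform su2Rep B (fun U => Real.sin (onePhase (onePhaseScale B) U) * ψ U) (fun U => Real.sin (onePhase (onePhaseScale B) U) * ψ U)
        ≤ linkCE B * Real.exp (-(physLevel (k + 1) * bareLambda B) + C₂ * bareLambda B ^ 2)
          * l2 (fun U => Real.sin (onePhase (onePhaseScale B) U) * ψ U) (fun U => Real.sin (onePhase (onePhaseScale B) U) * ψ U) := by
  set E := physLevel (k + 1) with hE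
  -- the threshold on `B` making the large-field rate small enough: `λ_b ≤ t := min 1 (2/(|E|+|C₁|+1))`
  set t : ℝ := min 1 (2 / (|E| + |C₁| + 1)) with ht
  have ht0 : 0 < t := lt_min one_pos (by positivity)
  set B₁' : ℝ := max B₁ (2 / t ^ 3) with hB₁'
  have hB₁'2 : 2 ≤ B₁' := hB₁.trans (le_max_left _ _)
  have hpos : ∀ B, B₁' ≤ B → 0 < B := fun B hB => by linarith
  have hmax : ∀ B, 0 < max B B₁' := fun B => lt_of_lt_of_le (by linarith) (le_max_right B B₁')
  refine absUpperOuter_of_valley k (A' := 144 * Real.pi ^ 2) (C₁ := C₁) (B₁ := B₁') hB₁'2 (by positivity)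
    (fun B => magPhase (onePhaseScale (max B B₁'))) (fun B => 12 * Real.pi / onePhaseScale (max B B₁'))
    (fun B => onePhaseScale (max B B₁'))
    (fun B => measurable_magPhase _) (fun B g U => magPhase_gaugeTransform _ g U) (fun B j z hz U => magPhase_twist _ j hz U)
    (fun B => div_nonneg (by positivity) (onePhaseScale_pos (hmax B)).le)
    (fun B U V => abs_magPhase_sub_le (onePhaseScale_pos (hmax B)) U V)
    (fun B hB => ?_) (fun B hB U hU => ?_) (fun B hB => ?_) (fun B hB ψ hψ => ?_)
  · rw [max_eq_left hB]; exact magPhaseScale_lipschitzSq (hpos B hB)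
  · rw [max_eq_left hB] at hU ⊢
    exact (lt_action_of_sin_magPhase_ne_zero (onePhaseScale_pos (hpos B hB)) hU).le
  · rw [max_eq_left hB]
    have hBt : 2 / t ^ 3 ≤ B := (le_max_right _ _).trans hB
    have hlt : bareLambda B ≤ t := bareLambda_le_of_le ht0 hBt
    exact exp_neg_mul_sqrt_bareLambda_le (hpos B hB) (hlt.trans (min_le_left _ _)) (hlt.trans (min_le_right _ _))
  · simp only [max_eq_left hB]
    exact hval B ((le_max_left _ _).trans hB) ψ hψ

end Summit.QuantumFields.YangMills.Theorems.FemtoTransferGap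

end
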